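import Summits.BirchSwinnertonDyer.BirchSwinnertonDyer.Theorems.AdditiveKolyvaginRoadCheb
import Summits.BirchSwinnertonDyer.BirchSwinnertonDyer.Theorems.AdditiveKolyvaginRoadLocalEquiv
import Summits.BirchSwinnertonDyer.BirchSwinnertonDyer.Theorems.AdditiveKolyvaginRoadIso
import HarnessLib

/-!
# Route `AdditiveKolyvaginRoad`, crux `KolyvaginPrimitiveAdditive` (item stmt-BirchSwinnertonDyer-20132):
# stub A1 `stub_rankLoweringAdditive` of the registered skeleton (line `birth`, v5, sha16 de262348) — PROVED
# (cell `pub/bsd-wall`, lead prover `bsd-wall-akr-p1` g2; `--supports stmt-BirchSwinnertonDyer-20132`, stub A1)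

`stub_rankLoweringAdditive` — **RANK LOWERING BY BERTOLINI–DARMON-ADMISSIBLE LEVEL RAISING AT AN ARBITRARY PRIME
`p ≥ 5`**, the registered stub-A1 text VERBATIM and UNCONDITIONAL: at every ♯ additive frame of crux 20132
(`5 ≤ p`, `Addv W p`, `ρ̄_{E,p}` onto, `K` imaginary quadratic with the Heegner hypothesis, …), for complex conjugation
`c ≠ 1` and the `ZMod p`-structure of `H¹(K, E[p])`, every non-zero class of a canonical level-raised eigen-Selmer
space `Sel_n^μ` (`n` a finite set of BD `1`-admissible primes; `AdditiveKolyvaginRoadLevelDefs`) is killed in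
`Sel_{n ∪ {q}}^μ` for some NEW admissible `q`, with `Sel_{n∪q}^μ ≤ Sel_n^μ` of codimension exactly one and
`Sel_{n∪q}^{−μ} = Sel_n^{−μ}` (W. Zhang 2014 Prop. 5.4 + Lemma 7.3 + (9.1)–(9.2), at `p² ∣ N`: no `p ∤ N` is used).

Assembly of the cell's kernel theorems, all `--supports stmt-BirchSwinnertonDyer-20132`:
* akr-p1 g0 — the reduction `selQP_rankLowering_of_localGlobal` of (A1) to (Cheb), (Equiv), (Line), (Trans), (Iso)
  (`AdditiveKolyvaginRoadRankLoweringReduction`, p511644), packaged by akr-p1 g2 as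
  `stub_rankLoweringAdditive_of_cheb_equiv` (`AdditiveKolyvaginRoadIso`, p520422; with (Line), (Trans) =
  `localLine_of_admQ`, `localTrans_of_admQ` of `AdditiveKolyvaginRoadLocalFrobenius`, p516317, and (Iso) =
  `hiso_of_admQ`);
* (Equiv) — `localEquiv_of_admQ` (`AdditiveKolyvaginRoadLocalEquiv`, p518618: the sign `ε_q` of complex conjugation on
  `H¹(K_q, E[p])`, Serre 1972 §1.8 with its factor `q`, W. Zhang (9.2));
* (Cheb) — `Cheb.exists_admissible_loc_ne_zero` (`AdditiveKolyvaginRoadCheb`: Čebotarev with the sign at `p ≥ 5`),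
  here put in the binder shape `localCheb_of_admQ` (`p ∣ N` from `Addv W p`; the sign `ν = sgn μ` of the class).

No named fact, no `sorry`; axioms standard.  References: [cite: WZhang2014, Prop. 5.4, Lemma 7.3, §9 (9.1)–(9.3)]
[cite: BertoliniDarmon2005, Lemma 2.6, Thm. 3.2] [cite: GrossLMS1991, §9 Prop. 9.3, 9.6] [cite: SerreInventiones1972,
§1.8 Prop. 6] [cite: MilneADT2006, Ch. I, Thm. 4.10(b)].
-/

-- single-conjunct summit: `Summit.BirchSwinnertonDyer.BirchSwinnertonDyer.…` repeats the name by design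
set_option linter.dupNamespace false

noncomputable section

open scoped Classical

namespace Summit.BirchSwinnertonDyer.BirchSwinnertonDyer.Theorems.AdditiveKoly

open WeierstrassCurve NumberField IsDedekindDomain
  Literature.NumberTheory.EllipticCurves Literature.NumberTheory.EllipticCurves.ModularForms
  Literature.NumberTheory.EllipticCurves.Rank1Residual Literature.NumberTheory.GaloisRepresentations Module

/-! ## §1 (Cheb) in the binder shape of the reduction -/

section Cheb

variable (W : WeierstrassCurve ℚ) [W.IsElliptic] [W.IsGloballyMinimal] (K : Type) [Field K] [NumberField K]
  (p : ℕ) [Fact p.Prime]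

/-- **(Cheb) of `selQP_rankLowering_of_localGlobal`, PROVED** (W. Zhang Lemma 7.3 ∕ Bertolini–Darmon Thm. 3.2 at a
general prime `p ≥ 5`): at an additive `p ≥ 5` with `ρ̄_{E,p}` onto, `K` imaginary quadratic with the Heegner
hypothesis for `N_E` and `c ≠ 1`, every non-zero class `x ∈ Sel_n^μ` is detected by the localisation at the place of
some NEW Bertolini–Darmon admissible `q ∉ n` (`Cheb.exists_admissible_loc_ne_zero` with the forbidden set `n`, the sign
`ν = sgn μ` of the `μ`-eigenclass `x`, and `p ∣ N_E` from `Addv W p`; the torsion exponent `p ^ 1` of `Vp` is `p`).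
[cite: WZhang2014, Lemma 7.3] [cite: BertoliniDarmon2005, Thm. 3.2] -/
theorem localCheb_of_admQ (h5 : 5 ≤ p) (hadd : Addv W p) (hsurj : W.HasSurjectiveModNGaloisRep p)
    (hK : IsImaginaryQuadratic K) (hH : SatisfiesHeegnerHypothesis (W.conductorNorm ℤ) K)
    {c : K ≃ₐ[ℚ] K} (hc1 : c ≠ 1) [Module (ZMod p) (Vp W K p)] :
    ∀ (n : Finset (AdmQ W K p)) (μ : Bool) (x : Vp W K p), x ∈ SelQP W K p c n μ → x ≠ 0 →
      ∃ q : AdmQ W K p, q ∉ n ∧ ∃ v : HeightOneSpectrum (𝓞 K),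
        ((q : ℕ) : 𝓞 K) ∈ v.asIdeal ∧ (W.baseChange K).torsionLocMap (v.adicCompletion K) ((p ^ 1 : ℕ) : ℤ) x ≠ 0 := by
  intro n μ x hx hx0
  have hp : p.Prime := Fact.out
  haveI : Fact (Nat.Prime (p ^ 1)) := ⟨by rw [pow_one]; exact hp⟩
  have h5' : 5 ≤ p ^ 1 := by rw [pow_one]; exact h5
  have hpN : p ∣ W.conductorNorm ℤ := (W.dvd_conductorNorm_iff_not_hasGoodReductionAtPrime p).mpr hadd.1
  have hpN' : p ^ 1 ∣ W.conductorNorm ℤ := by rw [pow_one]; exact hpN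
  have hsurj' : W.HasSurjectiveModNGaloisRep ((p ^ 1 : ℕ) : ℤ) := by rw [Nat.pow_one]; exact hsurj
  have hν : sgnP μ = 1 ∨ sgnP μ = -1 := by cases μ <;> simp [sgnP]
  have hxν : conjAct W c ((p ^ 1 : ℕ) : ℤ) x = sgnP μ • x := conjAct_eq_of_mem_selQP W K p c n μ hx
  obtain ⟨q, hqB, hadm, v, hqv, hloc⟩ := Cheb.exists_admissible_loc_ne_zero W K (p := p ^ 1) h5' hK hsurj' hpN' hH
    hc1 hν hx0 hxν (n.image Subtype.val)
  rw [Nat.pow_one] at hadm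
  refine ⟨⟨q, hadm⟩, fun hqn ↦ hqB (Finset.mem_image.mpr ⟨⟨q, hadm⟩, hqn, rfl⟩), v, hqv, fun h0 ↦ hloc h0⟩

end Cheb

/-! ## §2 Stub A1, PROVED -/

section Stub

/-- **Stub A1 of crux 20132 — RANK LOWERING BY BERTOLINI–DARMON-ADMISSIBLE LEVEL RAISING at a general additive prime
`p ≥ 5` — PROVED** (the registered text VERBATIM). At every ♯ additive frame, for complex conjugation `c ≠ 1` and the
`ZMod p`-structure of `H¹(K, E[p])`: every non-zero class of `Sel_n^μ` (`n` a finite set of BD `1`-admissible primes) is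
killed by passing to `Sel_{n ∪ {q}}^μ` for some NEW admissible `q`, with `Sel_{n∪q}^μ ≤ Sel_n^μ` of codimension exactly
one and `Sel_{n∪q}^{−μ} = Sel_n^{−μ}`. Proof: `stub_rankLoweringAdditive_of_cheb_equiv` (akr-p1 g0's five-input
reduction with (Line), (Trans), (Iso) supplied) fed with `localCheb_of_admQ` (Čebotarev with the sign) and
`localEquiv_of_admQ` (the sign of complex conjugation on `H¹(K_q, E[p])`). W. Zhang 2014 Prop. 5.4 + Lemma 7.3 +
(9.1)–(9.2) for the canonical level-raised spaces at `p² ∣ N`, in the kernel.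
[cite: WZhang2014, Prop. 5.4, Lemma 7.3, §9 (9.1)–(9.2)] [cite: BertoliniDarmon2005, Lemma 2.6, Thm. 3.2]
[cite: GrossLMS1991, Prop. 9.3, 9.6] -/
theorem stub_rankLoweringAdditive :
  ∀ (W : WeierstrassCurve ℚ) [W.IsElliptic] [W.IsGloballyMinimal] [NeZero (W.conductorNorm ℤ)]
    (p : ℕ) [Fact p.Prime] (K : Type) [Field K] [NumberField K]
    (Dt : ModularParametrizationData W (W.conductorNorm ℤ)) (β : ℤ) (ι : K →+* ℂ),
    5 ≤ p → Addv W p → W.HasSurjectiveModNGaloisRep p →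
    (∀ (ℓ : ℕ) [Fact ℓ.Prime], W.HasMultiplicativeReductionAtPrime ℓ →
      ¬ p ∣ padicValInt ℓ W.minimalDiscriminantInt) →
    (∃ (ℓ₁ ℓ₂ : ℕ) (_ : Fact ℓ₁.Prime) (_ : Fact ℓ₂.Prime), ℓ₁ ≠ ℓ₂ ∧
      W.HasMultiplicativeReductionAtPrime ℓ₁ ∧ W.HasMultiplicativeReductionAtPrime ℓ₂) →
    ¬ p ∣ W.tamagawaProduct → W.analyticRank = 1 →
    IsImaginaryQuadratic K → Odd (NumberField.discr K) →
    SatisfiesHeegnerHypothesis (W.conductorNorm ℤ) K →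
    (W.quadraticTwist (NumberField.discr K : ℚ)).entireLFunction 1 ≠ 0 →
    (4 * (W.conductorNorm ℤ : ℤ)) ∣ β ^ 2 - NumberField.discr K → ¬ (p : ℤ) ∣ Dt.c →
    ∀ (c : K ≃ₐ[ℚ] K), c ≠ 1 → ∀ [Module (ZMod p) (Vp W K p)],
      (∀ (n : Finset (AdmQ W K p)) (μ : Bool) (x : Vp W K p),
        x ∈ SelQP W K p c n μ → x ≠ 0 →
        ∃ q : AdmQ W K p, q ∉ n ∧
          x ∉ SelQP W K p c (insert q n) μ ∧
          SelQP W K p c (insert q n) μ ≤ SelQP W K p c n μ ∧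
          finrank (ZMod p) (SelQP W K p c (insert q n) μ) + 1 = finrank (ZMod p) (SelQP W K p c n μ) ∧
          SelQP W K p c (insert q n) (!μ) = SelQP W K p c n (!μ)) :=
  stub_rankLoweringAdditive_of_cheb_equiv fun W _ _ _ p _ K _ _ _ _ h5 hadd hsurj hK _ hH hc1 ↦
    ⟨localCheb_of_admQ W K p h5 hadd hsurj hK hH hc1, localEquiv_of_admQ W K p hK.1 hc1⟩

end Stub

end Summit.BirchSwinnertonDyer.BirchSwinnertonDyer.Theorems.AdditiveKoly

end
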